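import Summits.HodgeConjecture.CorCM.D2Bridge.Map43RecordAtPinLevels
import Summits.HodgeConjecture.CorCM.D2Bridge.NotHJLevelQRepresentatives
import Summits.HodgeConjecture.CorCM.B01.Transposition.HComp.RecordCarriers
import Summits.HodgeConjecture.HodgeCM.Model.TowerRes
import Summits.HodgeConjecture.HodgeCM.Model.TowerAlgebra
import Literature.NumberTheory.Automorphic.Liu2021.AppendixC.EtaleBettiComparison
import Literature.AlgebraicGeometry.HodgeTheory.ComplexBettiMapOfRationalBijective
import Literature.AlgebraicGeometry.Motives.AbelianVarietyProjectiveChart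
import Literature.RepresentationTheory.Semisimple.EquivariantIrreducibleDecomposition
import HarnessLib

/-!
# Line `a3-liu418`, GAP 1 «`stub_pinBettiPinning`» — the canonical-model Betti levels PINNED to the universe tower, GENERIC ASSEMBLY
# from the J2 interface `ComponentAlbanese` (Albanese on components)

Cell `hodgecm-mathlib` (D-0151), fan A, rung A-III, skeleton `Lines/a3-liu418.lean` (v3 1b96ade3f8b6b529 → v4, A-plan2 g1 ruling 03:02:04Z (1):
`StubPinBettiPinning`), seat A-p18 (director g1 02:56:13Z).  The v4 stub asks for an inhabitant of B-typ04's hypothesis structure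
`Sec42Data.BettiPinning C T τ' H rhoB` (`AppendixC/EtaleBettiComparison.lean` :185: injective level maps `b K : H¹_{B,τ'}(A_K, ℂ) → H`,
`b_hecke : rhoB g (b K' y) = b K (Alb(T_g)^* y)`, jointly exhaustive) at the PIN: `H := Tower hHD hI hU h₃ hA V` — the model's
`colim_K H¹(X_K(ℂ); ℂ)` built from the components `P_{Γ_h} = Γ_h\𝔹` (`HodgeCM/Model/TowerCarrier`) — with `rhoB := Representation.ofModule' H`
(= `towerRep`, `TowerAlgebra.of_smul_eq_act`), `C :=` the §4.2 datum of the honest canonical-model tower, `T :=` its Hecke translates.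

THIS FILE is the GENERIC assembly (theorems only, debt 0) from the J2 ⇄ J-record interface `ComponentAlbanese hHD hI hU h₃ hA V h Φ C T`
(`D2Bridge/ComponentAlbanese.lean`, d2bridge-prove-2 and -5: component Albanese morphisms `alb K h : P_{Γ_K,h} ⟶ A_K ⊗_{τ'} ℂ` with their laws
(ii) `Rel`, (iii) `Alb(u)`, (iv) `Alb(T_g)` on `H¹`), its rational level map `J.albStarQ K : H¹((A_K ⊗ ℂ)(ℂ); ℚ) → U_K = levelQ Γ_K`
(`Map43RecordAtPinLevels` §3 with `albStarQ_pull_albTr`), the rational form of the tower (`TowerRationalForm[Equivariant]`: `levelQ`, `inclQ`,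
`levelι : ℂ ⊗_ℚ U_K → H_K`, `translateQ`, `restrictQ`) and universal coefficients `Θ : ℂ ⊗_ℚ H¹(Y;ℚ) ≅ H¹(Y;ℂ)` (`ofRatClassBaseChange`):
* §1 `levelι_baseChange_restrictQ`, `levelι_baseChange_translateQ` — the complexification `levelι` intertwines the rational change of
  level / translate with the tower's `restrictLevel` / `translate`;
* §2 `levelι_surjective` — `ℂ ⊗_ℚ U_K → H_K` is ONTO (it is injective, `levelι_injective`; both sides have `ℂ`-dimension
  `Σ_q dim_ℚ H¹(P_{Γ_{g_q}}; ℚ)` over representatives `g_q` of `U(V)(L₀)\U(V)(𝔸_f)/K`: `LevelQReps.levelQEquivReps` on the rational side and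
  the injective evaluation at representatives on the complex side; class set finite by `Model.finite_shimuraIndex`, `4 ≤ [L:ℚ]`);
* §3 the level maps `b K := ofLevel Γ_K ∘ levelι ∘ (albStarQ K ⊗ ℂ) ∘ Θ_{A_K}⁻¹` and **`nonempty_bettiPinning_of_componentAlbanese`**:
  GIVEN `J`, the level law `(J.Γof K).K = K` and the bijectivity of every `J.albStarQ K` (at the pin: [Liu2021, Lem. 2.4 (1)] —
  `LevelQReps.bijective_albStarQ_componentAlbanesePinTotal_of_lemma24`), the tower IS pinned: `Nonempty (C.BettiPinning T τ' (Tower … V) (ofModule' _))`.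
The instantiation at the headline's face (`CV`, `TV`, the `_holds` witnesses, `τ' = ῑ₁`) is the sequel `A3Liu418PinBettiPinningAtPin.lean`.

HC_CM is proved only modulo the 7 printed citations (`hDel`, `h21`, `hLiu418`, `h411`, `h413`, `hD3`, `hD1''`) until rung 0 closes; nothing of
[Liu2021] is asserted here: the interface `J`, the level law and the bijectivity are HYPOTHESES of every theorem, and the universe's standing
rows `(hHD, hI, hU, h₃, hA)` and `h : exists_recordSystem` parametrise the carriers.

References: [Liu2021] Y. Liu, *Fourier–Jacobi cycles and arithmetic relative trace formula*, Camb. J. Math. 9 (2021) = arXiv:2102.11518, §4.2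
(FJcycle.tex l. 2062–2081), Lem. 2.4 (1) (l. 1210–1228), Thm. 4.18 proof (l. 2254–2257); [Deligne1979ShimuraVarieties] 2.1.2–2.1.4;
[HatcherAT2002] §3.1 (universal coefficients).
-/

set_option autoImplicit false

noncomputable section

open scoped TensorProduct
open CategoryTheory NumberField Function
open Literature.AlgebraicGeometry.Motives (AbelianVariety bettiCohomology ComplexPoints ofRatClassBaseChange)
open Literature.AlgebraicGeometry.HodgeTheory
open Literature.AlgebraicGeometry.ShimuraVarieties.UnitaryCanonicalModel (exists_recordSystem)
open Literature.AlgebraicTopology.SingularHomology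
open Literature.NumberTheory.Automorphic Literature.NumberTheory.Automorphic.Liu2021 Literature.NumberTheory.Automorphic.Liu2021.AppendixC
open Literature.NumberTheory.Automorphic.PicardCM
open Literature.NumberTheory.Transcendental (Arapura2012_Cor_15_4_6)
open HodgeCM HodgeCM.Model HodgeCM.Model.LevelTranslate HodgeCM.Model.TowerLevel HodgeCM.Model.TowerCarrier
open Summit.HodgeConjecture.CorCM.D2Bridge Summit.HodgeConjecture.CorCM.D2Bridge.TowerRational

namespace Summit.HodgeConjecture.CorCM.Lines.A3Liu418

-- NB (gate routing): the universe's standing rows `hHD ∕ hI ∕ hU ∕ h₃ ∕ hA` and the record fact `h` are PER-THEOREM binders below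
-- (never section `variable`s), exactly as in `D2Bridge/HcmPiecesAtPin.lean`; they parametrise the carriers and assert nothing.
variable {L : HodgeCM.CMField} {ι₁ : L →+* ℂ} {V : HodgeCM.HermSpace3 L ι₁}

/-! ## §1 The complexification `levelι : ℂ ⊗_ℚ U_K → H_K` intertwines change of level and translates -/

/-- `levelι ∘ (restrictQ ⊗ ℂ) = restrictLevel ∘ levelι` (from `inclQ_restrictQ`). [folklore] -/
theorem levelι_baseChange_restrictQ (hHD : exists_isReal_hodgeModel) (hI : hodgePQ_independent_of_hodgeModel)
    (hU : BallQuotientUniformisedDatum) (h₃ : CMAbelianVarietyRealised) (hA : Arapura2012_Cor_15_4_6) {Γ Γ' : HodgeCM.Level V} (hle : Γ' ≤ Γ) (hΓ : Γ.BelowConjThree) (hΓ' : Γ'.BelowConjThree)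
    (s : ℂ ⊗[ℚ] levelQ hHD hI hU h₃ hA Γ hΓ) :
    levelι hHD hI hU h₃ hA Γ' hΓ' ((restrictQ hHD hI hU h₃ hA hle hΓ hΓ').baseChange ℂ s) =
      restrictLevel hHD hI hU h₃ hA hle hΓ hΓ' (levelι hHD hI hU h₃ hA Γ hΓ s) := by
  induction s using TensorProduct.induction_on with
  | zero => simp only [map_zero]
  | tmul z c => rw [LinearMap.baseChange_tmul, levelι_tmul, levelι_tmul, map_smul, inclQ_restrictQ]
  | add s t hs ht => simp only [map_add, hs, ht]

/-- `levelι ∘ (translateQ g ⊗ ℂ) = translate g ∘ levelι` (from `inclQ_translateQ`). [folklore] -/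
theorem levelι_baseChange_translateQ (hHD : exists_isReal_hodgeModel) (hI : hodgePQ_independent_of_hodgeModel)
    (hU : BallQuotientUniformisedDatum) (h₃ : CMAbelianVarietyRealised) (hA : Arapura2012_Cor_15_4_6) {Γ : HodgeCM.Level V} (hΓ : Γ.BelowConjThree) (g : V.adelicFin)
    (s : ℂ ⊗[ℚ] levelQ hHD hI hU h₃ hA Γ hΓ) :
    levelι hHD hI hU h₃ hA (Γ.conj g hΓ) (hΓ.conj g) ((translateQ hHD hI hU h₃ hA hΓ g).baseChange ℂ s) =
      translate hHD hI hU h₃ hA hΓ g (levelι hHD hI hU h₃ hA Γ hΓ s) := by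
  induction s using TensorProduct.induction_on with
  | zero => simp only [map_zero]
  | tmul z c => rw [LinearMap.baseChange_tmul, levelι_tmul, levelι_tmul, map_smul, inclQ_translateQ]
  | add s t hs ht => simp only [map_add, hs, ht]

/-! ## §2 `ℂ ⊗_ℚ U_K → H_K` is onto (dimension count over representatives) -/

/-- Evaluation of a complex equivariant family at a covering family of indices is injective (A-p09's argument: every index is
`Rel`-related to some `g q`, and the family's value at `h` is the translate of its value there). [cite: Deligne1979ShimuraVarieties, 2.1.2] -/
theorem eval_injective_of_cover (hHD : exists_isReal_hodgeModel) (hI : hodgePQ_independent_of_hodgeModel)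
    (hU : BallQuotientUniformisedDatum) (h₃ : CMAbelianVarietyRealised) (hA : Arapura2012_Cor_15_4_6) {Γ : HodgeCM.Level V} (hΓ : Γ.BelowConjThree) {Ξ : Type} (g : Ξ → V.adelicFin)
    (hcov : ∀ hh : V.adelicFin, ∃ (q : Ξ) (γ : ↥(Urat V)), TowerLevel.Rel Γ γ hh (g q)) :
    Injective (fun c : towerLevel hHD hI hU h₃ hA Γ hΓ => fun q : Ξ => (c : Π hh, W hHD hI hU h₃ Γ hΓ hh) (g q)) := by
  intro c d hcd
  apply Subtype.ext
  funext hh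
  obtain ⟨q, γ, r⟩ := hcov hh
  have hq := congrFun hcd q
  rw [apply_eq_trPull hHD hI hU h₃ hA c r (transCond_of_rel hΓ r), apply_eq_trPull hHD hI hU h₃ hA d r (transCond_of_rel hΓ r)]
  exact congrArg _ hq

/-- **`levelι : ℂ ⊗_ℚ U_K → H_K` is SURJECTIVE** (`4 ≤ [L:ℚ]`): injective (`levelι_injective`) between `ℂ`-spaces of the same finite
dimension `Σ_q dim_ℚ H¹(P_{Γ_{g_q}}; ℚ)` (`levelQEquivReps` ∕ the injective evaluation at representatives; the class set
`U(V)(L₀)\U(V)(𝔸_f)/K` is finite, `Model.finite_shimuraIndex`). [cite: Deligne1979ShimuraVarieties, 2.1.2] -/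
theorem levelι_surjective (hHD : exists_isReal_hodgeModel) (hI : hodgePQ_independent_of_hodgeModel)
    (hU : BallQuotientUniformisedDatum) (h₃ : CMAbelianVarietyRealised) (hA : Arapura2012_Cor_15_4_6) (h4 : 4 ≤ Module.finrank ℚ L) {Γ : HodgeCM.Level V} (hΓ : Γ.BelowConjThree) :
    Surjective (levelι hHD hI hU h₃ hA Γ hΓ) := by
  classical
  obtain ⟨g, hg, ⟨e⟩⟩ := LevelQReps.nonempty_levelQ_linearEquiv_pi hHD hI hU h₃ hA (Γ := Γ) hΓ
  haveI := Summit.HodgeConjecture.CorCM.Model.finite_shimuraIndex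
    (⟨V.Hm, V.isHermitian, V.signature_ι₁, V.posDef_of_ne⟩ : Summit.HodgeConjecture.CorCM.HermSpace3 ⟨L.K⟩ ι₁) h4 Γ.K Γ.isOpen_K
  letI := Fintype.ofFinite
    (MulAction.orbitRel.Quotient ↥(Urat V) (Literature.NumberTheory.Automorphic.ShimuraDissection.CosetSpace (ρ V) Γ.K))
  -- the injective evaluation of complex families at the representatives
  let ev : towerLevel hHD hI hU h₃ hA Γ hΓ →ₗ[ℂ] (∀ q, W hHD hI hU h₃ Γ hΓ (g q)) :=
    { toFun := fun c q => (c : Π hh, W hHD hI hU h₃ Γ hΓ hh) (g q)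
      map_add' := fun _ _ => rfl
      map_smul' := fun _ _ => rfl }
  have hev : Injective ev :=
    eval_injective_of_cover hHD hI hU h₃ hA hΓ g (LevelQReps.exists_rel_of_representatives g hg)
  haveI : Module.Finite ℂ (towerLevel hHD hI hU h₃ hA Γ hΓ) := Module.Finite.of_injective ev hev
  -- dimension count
  have h1 : Module.finrank ℂ (towerLevel hHD hI hU h₃ hA Γ hΓ) ≤ Module.finrank ℂ (∀ q, W hHD hI hU h₃ Γ hΓ (g q)) :=
    LinearMap.finrank_le_finrank_of_injective hev
  have h2 : Module.finrank ℂ (∀ q, W hHD hI hU h₃ Γ hΓ (g q)) = Module.finrank ℚ (∀ q, WQ hHD hI hU h₃ Γ hΓ (g q)) := by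
    rw [Module.finrank_pi_fintype, Module.finrank_pi_fintype]
    refine Finset.sum_congr rfl fun q _ => ?_
    exact Module.finrank_baseChange (R := ℂ) (S := ℚ) (M' := WQ hHD hI hU h₃ Γ hΓ (g q))
  have h3 : Module.finrank ℚ (∀ q, WQ hHD hI hU h₃ Γ hΓ (g q)) = Module.finrank ℚ (levelQ hHD hI hU h₃ hA Γ hΓ) :=
    e.finrank_eq.symm
  have h4' : Module.finrank ℂ (ℂ ⊗[ℚ] levelQ hHD hI hU h₃ hA Γ hΓ) = Module.finrank ℚ (levelQ hHD hI hU h₃ hA Γ hΓ) :=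
    Module.finrank_baseChange (R := ℂ) (S := ℚ) (M' := levelQ hHD hI hU h₃ hA Γ hΓ)
  haveI : Module.Finite ℚ (levelQ hHD hI hU h₃ hA Γ hΓ) := Module.Finite.equiv e.symm
  have hinj := levelι_injective hHD hI hU h₃ hA Γ hΓ
  have h5 : Module.finrank ℂ (ℂ ⊗[ℚ] levelQ hHD hI hU h₃ hA Γ hΓ) ≤ Module.finrank ℂ (towerLevel hHD hI hU h₃ hA Γ hΓ) :=
    LinearMap.finrank_le_finrank_of_injective hinj
  have heq : Module.finrank ℂ (ℂ ⊗[ℚ] levelQ hHD hI hU h₃ hA Γ hΓ) = Module.finrank ℂ (towerLevel hHD hI hU h₃ hA Γ hΓ) := by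
    omega
  exact (LinearMap.injective_iff_surjective_of_finrank_eq_finrank heq).1 hinj

/-! ## §3 The pinning from a `ComponentAlbanese` interface -/

section Pinning

variable [Algebra L ℂ]

/-- Rational singular homology of the complex points of a base-changed abelian variety is finite-dimensional (smooth projective,
`finite_singularHomology_rat_complexPoints`). [folklore] -/
theorem finite_singularHomology_baseChange (A : AbelianVariety L) (k : ℕ) :
    Module.Finite ℚ (singularHomology ℚ ℚ (ComplexPoints (A.baseChange ℂ).X) k) :=
  finite_singularHomology_rat_complexPoints (AbelianVariety.isSmoothProjective_holds (A := A.baseChange ℂ)) k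

/-- **Universal coefficients at an Albanese level**: `Θ_A : ℂ ⊗_ℚ H¹((A ⊗ ℂ)(ℂ); ℚ) ≃ H¹((A ⊗ ℂ)(ℂ); ℂ)` is a bijection.
[cite: HatcherAT2002, §3.1 Thm. 3.2 and p. 198] -/
theorem ofRatClassBaseChange_baseChange_bijective (A : AbelianVariety L) :
    Bijective (ofRatClassBaseChange (ComplexPoints (A.baseChange ℂ).X) 1) := by
  haveI := finite_singularHomology_baseChange (L := L) A 1
  exact ofRatClassBaseChange_bijective _ 1

/-- **Naturality of `Θ` for `bettiPullAlong`** along the base-change structure `algebraMap L ℂ`: `φ^*_ℂ (Θ t) = Θ ((φ_ℂ^* ⊗ ℂ) t)` for a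
homomorphism `φ : A ⟶ B` over `L` (`bettiH1Along A (algebraMap L ℂ)` IS `H¹((A ⊗ ℂ)(ℂ); ℂ)` by `rfl`). [cite: HatcherAT2002, §3.1 p. 198] -/
theorem bettiPullAlong_ofRatClassBaseChange {A B : AbelianVariety L} (φ : A ⟶ B) (t : ℂ ⊗[ℚ] bettiCohomology (B.baseChange ℂ).X 1) :
    bettiPullAlong (algebraMap (L : Type) ℂ) φ (ofRatClassBaseChange (ComplexPoints (B.baseChange ℂ).X) 1 t) =
      ofRatClassBaseChange (ComplexPoints (A.baseChange ℂ).X) 1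
        ((BettiUniverse.pull (AbelianVariety.Hom.baseChange ℂ φ).hom.hom.hom 1).baseChange ℂ t) := by
  rw [bettiPullAlong_def]
  exact complexBetti_map_ofRatClassBaseChange (AbelianVariety.Hom.baseChange ℂ φ).hom.hom.hom 1 t

set_option maxHeartbeats 4000000 in
set_option synthInstance.maxHeartbeats 400000 in
/-- **THE PINNING from the J2 interface.**  Over `(L, ι₁, V)` with `4 ≤ [L:ℚ]`, a §4.2 datum `C` on the honest canonical-model tower with
translates `T`, a base-change structure `L → ℂ` (the pinning is along `τ' := algebraMap L ℂ`), a `ComponentAlbanese` interface `J` (component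
Albanese morphisms `P_{Γ_K,h} ⟶ A_K ⊗ ℂ` + laws (ii)–(iv)), the LEVEL LAW `(J.Γof K).K = K` and the BIJECTIVITY of every `J.albStarQ K`
(Liu's Lem. 2.4 (1) at the pin): the universe tower `Tower … V = colim_K H¹(X_K(ℂ); ℂ)` with its Hecke action `ofModule' = towerRep` IS pinned
to the Albanese Betti levels `H¹_{B,τ'}(A_K, ℂ)` along `b K := ofLevel Γ_K ∘ levelι ∘ (albStarQ K ⊗ ℂ) ∘ Θ_{A_K}⁻¹`: `b K` injective
(`ofLevel_injective`, `levelι_injective`, `albStarQ` bijective, `Θ` bijective), `b_hecke` (LAW (iv) `albStarQ_pull_albTr` +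
`levelι_baseChange_translateQ/_restrictQ` + `act_ofLevel` + `ofLevel_restrictLevel`), exhaustive (`exists_ofLevel`, the small level `Γ.K ⊓ K₀`
below any tower level, `levelι_surjective`, `albStarQ` onto). [cite: Liu2021, §4.2 (FJcycle.tex l. 2062–2081); Lemma 2.4 (1) (l. 1210–1228)]
[cite: Deligne1979ShimuraVarieties, 2.1.2–2.1.4] -/
theorem nonempty_bettiPinning_of_componentAlbanese (hHD : exists_isReal_hodgeModel) (hI : hodgePQ_independent_of_hodgeModel)
    (hU : BallQuotientUniformisedDatum) (h₃ : CMAbelianVarietyRealised) (hA : Arapura2012_Cor_15_4_6) (V : HodgeCM.HermSpace3 L ι₁) (h : exists_recordSystem) (Φ : Literature.AlgebraicGeometry.Motives.CMType L) {isotropicAt : ℕ → Prop}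
    (C : Sec42Data (Model.honestP5Of h ⟨L.K⟩ ι₁ ⟨V.Hm, V.isHermitian, V.signature_ι₁, V.posDef_of_ne⟩ Φ) isotropicAt)
    (T : C.HeckeTranslates) (h4 : 4 ≤ Module.finrank ℚ L)
    (J : ComponentAlbanese hHD hI hU h₃ hA V h Φ C T)
    (hΓ : ∀ K : C5.SmallLevel C.S.K₀, (J.Γof K).K = K.1.1)
    (hbij : ∀ K : C5.SmallLevel C.S.K₀, Bijective (J.albStarQ K)) :
    Nonempty (C.BettiPinning T (algebraMap (L : Type) ℂ) (Tower hHD hI hU h₃ hA V)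
      (Representation.ofModule' (k := ℂ) (G := C.G) (Tower hHD hI hU h₃ hA V))) := by
  classical
  -- Θ at every level, as a linear equivalence
  let Θ : ∀ K : C5.SmallLevel C.S.K₀,
      (ℂ ⊗[ℚ] bettiCohomology ((C.A K).baseChange ℂ).X 1) ≃ₗ[ℂ] C.bettiH1 (algebraMap (L : Type) ℂ) K := fun K =>
    LinearEquiv.ofBijective (ofRatClassBaseChange (ComplexPoints ((C.A K).baseChange ℂ).X) 1)
      (ofRatClassBaseChange_baseChange_bijective (L := L) (C.A K))
  have hΘ : ∀ K t, Θ K t = ofRatClassBaseChange (ComplexPoints ((C.A K).baseChange ℂ).X) 1 t := fun K t => rfl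
  -- the level maps
  let b : ∀ K : C5.SmallLevel C.S.K₀, C.bettiH1 (algebraMap (L : Type) ℂ) K →ₗ[ℂ] Tower hHD hI hU h₃ hA V := fun K =>
    ofLevel hHD hI hU h₃ hA (J.Γof K) (J.belowConjThree K) ∘ₗ levelι hHD hI hU h₃ hA (J.Γof K) (J.belowConjThree K) ∘ₗ
      (J.albStarQ K).baseChange ℂ ∘ₗ (Θ K).symm.toLinearMap
  have hb : ∀ K y, b K y = ofLevel hHD hI hU h₃ hA (J.Γof K) (J.belowConjThree K)
      (levelι hHD hI hU h₃ hA (J.Γof K) (J.belowConjThree K) ((J.albStarQ K).baseChange ℂ ((Θ K).symm y))) := fun K y => rfl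
  -- LAW (iv) base-changed to `ℂ`
  have hlaw : ∀ (g : C.G) (K K' : C5.SmallLevel C.S.K₀) (hK : C5.HeckeLE g K K')
      (t : ℂ ⊗[ℚ] bettiCohomology ((C.A K').baseChange ℂ).X 1),
      (J.albStarQ K).baseChange ℂ
          ((BettiUniverse.pull (AbelianVariety.Hom.baseChange ℂ (T.albTr g K K' hK)).hom.hom.hom 1).baseChange ℂ t) =
        (restrictQ hHD hI hU h₃ hA (J.Γof_hecke g hK) ((J.belowConjThree K').conj g) (J.belowConjThree K)).baseChange ℂ
          ((translateQ hHD hI hU h₃ hA (J.belowConjThree K') g).baseChange ℂ ((J.albStarQ K').baseChange ℂ t)) := by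
    intro g K K' hK t
    induction t using TensorProduct.induction_on with
    | zero => simp only [map_zero]
    | tmul z x =>
      rw [LinearMap.baseChange_tmul, LinearMap.baseChange_tmul, LinearMap.baseChange_tmul, LinearMap.baseChange_tmul,
        LinearMap.baseChange_tmul, J.albStarQ_pull_albTr g hK x]
    | add s s' hs hs' => simp only [map_add, hs, hs']
  refine ⟨{ b := b, b_injective := ?_, b_hecke := ?_, exhaust := ?_ }⟩
  · -- injectivity
    intro K
    have h1 : Injective ((J.albStarQ K).baseChange ℂ) :=
      ((LinearEquiv.ofBijective (J.albStarQ K) (hbij K)).baseChange ℚ ℂ _ _).injective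
    exact (ofLevel_injective hHD hI hU h₃ hA (J.Γof K) (J.belowConjThree K)).comp
      ((levelι_injective hHD hI hU h₃ hA (J.Γof K) (J.belowConjThree K)).comp (h1.comp (Θ K).symm.injective))
  · -- Hecke compatibility
    intro g K K' hK y
    have hact : Representation.ofModule' (k := ℂ) (G := C.G) (Tower hHD hI hU h₃ hA V) g (b K' y) = act hHD hI hU h₃ hA g (b K' y) :=
      (Literature.RepresentationTheory.Semisimple.ofModule'_apply_eq_of_smul (k := ℂ) (G := C.G)
        (Tower hHD hI hU h₃ hA V) g (b K' y)).trans (of_smul_eq_act hHD hI hU h₃ hA g (b K' y))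
    rw [hact, hb, hb, act_ofLevel]
    -- move `Θ⁻¹` through the pull-back
    have hy : (Θ K).symm (bettiPullAlong (algebraMap (L : Type) ℂ) (T.albTr g K K' hK) y) =
        (BettiUniverse.pull (AbelianVariety.Hom.baseChange ℂ (T.albTr g K K' hK)).hom.hom.hom 1).baseChange ℂ ((Θ K').symm y) := by
      apply (Θ K).injective
      rw [LinearEquiv.apply_symm_apply, hΘ, ← bettiPullAlong_ofRatClassBaseChange, ← hΘ K', LinearEquiv.apply_symm_apply]
    rw [hy, hlaw, levelι_baseChange_restrictQ, levelι_baseChange_translateQ, ofLevel_restrictLevel]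
  · -- exhaustiveness
    intro x
    obtain ⟨Γ, hΓ3, c, rfl⟩ := exists_ofLevel hHD hI hU h₃ hA x
    -- a small level below `Γ`: `K := Γ.K ⊓ K₀`
    let K₀ : Subgroup V.adelicFin := C.S.K₀.1
    have hKo : IsOpen ((Γ.K ⊓ K₀ : Subgroup V.adelicFin) : Set V.adelicFin) := Γ.isOpen_K.inter C.S.K₀.2.1
    let K : C5.SmallLevel C.S.K₀ :=
      ⟨⟨Γ.K ⊓ K₀, ⟨hKo, Γ.isCompact_K.of_isClosed_subset (Subgroup.isClosed_of_isOpen _ hKo) Set.inter_subset_left⟩⟩,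
        fun x hx => hx.2⟩
    have hle : J.Γof K ≤ Γ := by
      refine HodgeCM.Level.le_def.mpr ?_
      rw [hΓ K]
      exact fun x hx => hx.1
    -- the restricted family is a complex family at `Γ_K`, hence the image of an Albanese class
    obtain ⟨s, hs⟩ := levelι_surjective hHD hI hU h₃ hA h4 (J.belowConjThree K) (restrictLevel hHD hI hU h₃ hA hle hΓ3 (J.belowConjThree K) c)
    have hsurj : Surjective ((J.albStarQ K).baseChange ℂ) :=
      ((LinearEquiv.ofBijective (J.albStarQ K) (hbij K)).baseChange ℚ ℂ _ _).surjective
    obtain ⟨t, ht⟩ := hsurj s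
    refine ⟨K, Θ K t, ?_⟩
    rw [hb, LinearEquiv.symm_apply_apply, ht, hs, ofLevel_restrictLevel]

end Pinning

end Summit.HodgeConjecture.CorCM.Lines.A3Liu418

end
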